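import Summits.ABC.IUTFork.Joshi.LogShellsBKModel
import Literature.IUT.LogThetaLattice.LogLinkIteratesUnramified
import HarnessLib

/-!
# [J-III] Prop. 9.2.1.5 (3) AS TYPED (`LogShellIsBlochKato`, slot T-19) — its truth value at the honest model `BlochKatoDatum.model p`

Proof-only companion of the abc-iut cell, branch E (rung LADDER-ABC:A2.E; seat abc-iut-E-t19, AUTHORS-FIRST DERIVABLE/NV row on its
own files `LogShellsJoshi.lean` p429212, `LogShellsBKBridgeNormalised.lean` p431396, `LogShellsBKModel.lean` p432045). Source of
record: Joshi, *Construction of Arithmetic Teichmüller Spaces III*, arXiv:2401.13508v4, render `lit/renders/Joshi-arxiv-2401.13508/`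
p. 95 l. 20–25 ((9.1.1.3) «explicitly given as `q ↦ (log_E(q), v_E(q))`»), p. 96 l. 35–50 (Def. 9.2.1.1 `I = (1/p)·log(𝒪^*)`, `(1/4)·…`
for `p = 2`), p. 97 l. 19–28 (Prop. 9.2.1.5 (3) «`I((X/L_v,X^an/K_v)) = H¹_f(G_{L_v;K_v}, ℤ_p(1)) = H¹_e(…)`», (4)).

WHAT IS DECIDED HERE (kernel, no judgement on print). Slot T-19 typed (3) LITERALLY through Joshi's explicit identification (9.1.1.3):
`LogShellIsBlochKato D := toE″(HZ ∩ H¹_f) = I ∧ toE(H¹_f) = I^{ℚ_p}` with `toE(κ(q)) = log_E(q)`. Over `E = ℚ_p`: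
* for EVERY §9.1.1 datum whose integral `H¹_e`-classes are unit classes (`IntegralClassesAreUnitClasses`, the Kummer-theory property
  of the intended model, p431396) the integral half of (3) as typed is FALSE: `toE″(HZ ∩ H¹_f) = log_p(ℤ_p^×) ∌ 1` while
  `1 ∈ 𝒪 ⊆ I` (Lemma 9.2.1.4) — `not_logShellIsBlochKato_of_integralClassesAreUnitClasses`; in particular at the honest model
  (`not_model_logShellIsBlochKato`), for every prime `p` (also `p = 2`);
* the rational half of (3) HOLDS at every datum (`Hf_map_toE_eq`, p429212) and the integral half HOLDS after the `p*`-twist of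
  (9.7.2.2) (`mochizukiLogShell_eq_smul_toE_image`, p431396): `I = (p*)⁻¹ · toE″(HZ ∩ H¹_f)` — `model_prop9215_3_profile`.
So the claim-Prop is CONTENTFUL, and its truth at the intended model is EXACTLY the normalisation constant `p*` between (9.1.1.3)
and Def. 9.2.1.1 / (9.7.2.2) (referee flags E-ref-2 F-1/F-2 on the §9.7 twin; gen-0's «RECORDED NEUTRALLY» note in LogShellsJoshi).
CONSUMPTION RULE for the cell: a FILLS-modulo line taking `LogShellIsBlochKato D` (or `AdelicLogShellIsBlochKato`) as a hypothesis is
VACUOUS at the honest model over `ℚ_p`; take the `p*`-normalised `LocalBKDatum.LogShellEqLogBKImage` of p431396 instead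
(`model_logShellEqLogBKImage` holds).

Inputs BY NAME: `Literature.IUT.LogThetaLattice.Padic.norm_unitLog_lt_one` (`‖log_p u‖ < 1` on `ℤ_p^×`, tree), `closedBall_subset_
mochizukiLogShell` (Lemma 9.2.1.4, p429212), `model_toE_image_integral_eq` (p432045). No new `def`/`Prop`; no `Cor312*`/`Thm311*`
import (E-PLAN R14). A model exhibits (un)satisfiability of a typed reading, nothing more; unrefereed preprint — indexed ≠ endorsed;
typed ≠ proved; no side taken on [IUTchIII] Cor. 3.12 or on any author (Mochizuki / Scholze–Stix / Joshi / Dupuy–Hilado).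
-/

set_option autoImplicit false

noncomputable section

open Set Metric
open scoped Pointwise

namespace Summit.ABC.IUTFork.Joshi

open Literature.IUT.LogVolume Literature.AnabelianGeometry.AbsoluteAnabelian

variable (p : ℕ) [Fact p.Prime]

/-! ## 1. Two facts about `ℚ_p`: `1 ∉ log_p(ℤ_p^×)` and `1 ∈ I` -/

/-- `1 ∉ log_p(ℤ_p^×)`: every `log_p u`, `u ∈ ℤ_p^×`, has norm `< 1` (tree: `Padic.norm_unitLog_lt_one`). [folklore] -/
theorem one_not_mem_logUnits_padic : (1 : ℚ_[p]) ∉ logUnits ℚ_[p] := by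
  rintro ⟨u, hu, h1⟩
  have h := Literature.IUT.LogThetaLattice.Padic.norm_unitLog_lt_one p (u := u) hu
  rw [h1, norm_one] at h
  exact lt_irrefl _ h

/-- `1 ∈ I = (1/p*)·log_p(ℤ_p^×)` (Lemma 9.2.1.4: `𝒪 ⊆ I`). [folklore] -/
theorem one_mem_mochizukiLogShell_padic : (1 : ℚ_[p]) ∈ mochizukiLogShell p ℚ_[p] :=
  closedBall_subset_mochizukiLogShell p ℚ_[p] (by rw [mem_closedBall, dist_zero_right, norm_one])

/-- Hence `log_p(ℤ_p^×) ≠ I` in `ℚ_p` — the two differ (by the factor `p*`). [folklore] -/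
theorem logUnits_ne_mochizukiLogShell_padic : logUnits ℚ_[p] ≠ mochizukiLogShell p ℚ_[p] := fun h =>
  one_not_mem_logUnits_padic p (h.symm ▸ one_mem_mochizukiLogShell_padic p)

/-! ## 2. Prop. 9.2.1.5 (3) as typed, over `ℚ_p` -/

namespace BlochKatoDatum

variable {p} {H1 : Type} [AddCommGroup H1] [Module ℚ_[p] H1]

/-- For ANY §9.1.1 datum over `ℚ_p` with `IntegralClassesAreUnitClasses`, the integral identification of (9.1.1.3) carries
`HZ ∩ H¹_f` onto `log_p(ℤ_p^×)` exactly (p431396 `toE_image_integral_eq`, moved from `H¹_e` to `H¹_f` by `e = f`). [folklore] -/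
theorem toE_image_integral_Hf_eq (D : BlochKatoDatum p ℚ_[p] H1) (h : D.IntegralClassesAreUnitClasses) :
    D.toE '' (D.integral D.Hf : Set H1) = logUnits ℚ_[p] := by
  rw [← D.integral_He_eq_integral_Hf]
  exact D.toE_image_integral_eq h

/-- **Prop. 9.2.1.5 (3) AS TYPED is FALSE over `ℚ_p` under `IntegralClassesAreUnitClasses`**: its integral half would read
`log_p(ℤ_p^×) = I ∋ 1`. [folklore] -/
theorem not_logShellIsBlochKato_of_integralClassesAreUnitClasses (D : BlochKatoDatum p ℚ_[p] H1)
    (h : D.IntegralClassesAreUnitClasses) : ¬ LogShellIsBlochKato D := by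
  rintro ⟨h3, -⟩
  rw [D.toE_image_integral_Hf_eq h] at h3
  exact logUnits_ne_mochizukiLogShell_padic p h3

variable (p)

/-- **VERDICT AT THE HONEST MODEL** (p432045 `model p`: `H¹ = ℚ_p × ℚ_p`, `κ(q) = (log_p(unit part), v_p(q))`, `HZ` = the Kummer
image): `LogShellIsBlochKato (model p)` is FALSE, for every prime `p`. [folklore] -/
theorem not_model_logShellIsBlochKato : ¬ LogShellIsBlochKato (model p) :=
  (model p).not_logShellIsBlochKato_of_integralClassesAreUnitClasses (model_integralClassesAreUnitClasses p)

/-- … while the RATIONAL half of (3) holds at the model (`toE(H¹_f) = I^{ℚ_p} = ℚ_p`; general, p429212). [folklore] -/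
theorem model_Hf_map_toE_eq : (model p).Hf.map (model p).toE = mochizukiLogShellQ p ℚ_[p] :=
  Hf_map_toE_eq (model p)

/-- … and the INTEGRAL half holds at the model in the `p*`-normalisation of (9.7.2.2) (p431396): `I = (p*)⁻¹ · toE″(HZ ∩ H¹_f)`.
[folklore] -/
theorem model_mochizukiLogShell_eq_smul_toE_image :
    mochizukiLogShell p ℚ_[p] =
      ((p ^ (if p = 2 then 2 else 1) : ℕ) : ℚ_[p])⁻¹ • ((model p).toE '' ((model p).integral (model p).Hf : Set (ℚ_[p] × ℚ_[p]))) :=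
  (model p).mochizukiLogShell_eq_smul_toE_image (model_integralClassesAreUnitClasses p)

/-- … and the typed integral image is `log_p(ℤ_p^×)` on the nose. [folklore] -/
theorem model_toE_image_integral_Hf_eq :
    (model p).toE '' ((model p).integral (model p).Hf : Set (ℚ_[p] × ℚ_[p])) = logUnits ℚ_[p] :=
  (model p).toE_image_integral_Hf_eq (model_integralClassesAreUnitClasses p)

/-- **PROFILE of J3:Prop9.2.1.5(3) at the honest model**: as typed FALSE; rational half TRUE; `p*`-twisted integral half TRUE.
The claim-Prop is contentful and its truth at the intended model is exactly the constant `p*`. [folklore] -/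
theorem model_prop9215_3_profile :
    ¬ LogShellIsBlochKato (model p) ∧
      (model p).Hf.map (model p).toE = mochizukiLogShellQ p ℚ_[p] ∧
      mochizukiLogShell p ℚ_[p] =
        ((p ^ (if p = 2 then 2 else 1) : ℕ) : ℚ_[p])⁻¹ •
          ((model p).toE '' ((model p).integral (model p).Hf : Set (ℚ_[p] × ℚ_[p]))) :=
  ⟨not_model_logShellIsBlochKato p, model_Hf_map_toE_eq p, model_mochizukiLogShell_eq_smul_toE_image p⟩

end BlochKatoDatum

/-! ## 3. The adelic twin (Prop. 9.2.2.4 as typed, `AdelicLogShellIsBlochKato`) at a one-place family of honest models -/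

/-- At any family of places all of residue characteristic `p` carrying the honest model at each place, the componentwise claim
`AdelicLogShellIsBlochKato` (Prop. 9.2.2.4 as typed) FAILS as soon as there is one place. [folklore] -/
theorem not_adelicLogShellIsBlochKato_model {V : Type*} (v₀ : V) :
    ¬ AdelicLogShellIsBlochKato (V := V) (fun _ => p) (fun _ => ℚ_[p] × ℚ_[p]) (fun _ => BlochKatoDatum.model p) :=
  fun h => BlochKatoDatum.not_model_logShellIsBlochKato p (h v₀)

end Summit.ABC.IUTFork.Joshi

end
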